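import Mathlib
import Summits.Ventures.PercRepro2.Defs
import Summits.Ventures.PercRepro2.Independence
import Summits.Ventures.PercRepro2.Harris
import Summits.Ventures.PercRepro2.Graph
import Summits.Ventures.PercRepro2.Exploration
import Summits.Ventures.PercRepro2.Events
import Summits.Ventures.PercRepro2.FourFunctions
import Summits.Ventures.PercRepro2.Induced
import Summits.Ventures.PercRepro2.Frontier
import Summits.Ventures.PercRepro2.ObsIndependence
import Summits.Ventures.PercRepro2.BHK
import Summits.Ventures.PercRepro2.MultiSource
import Summits.Ventures.PercRepro2.SeedSet

/-!
# The functional multi-source van den Berg–Häggström–Kahn inequality (blind cell PercRepro2, typer-1)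

For a seed set `T`, the union cluster `C^U_T = ⋃_{s ∈ T} C^U_s` in `G[U]` (`clusterInT`), nonnegative
monotone functionals `F₁, F₂ : Set V → R`, and avoided vertex sets `X, Y ⊆ U`
(`R^U_{T,X} = {s ↮ x in G[U] ∀ s ∈ T, x ∈ X}`, p1's `REventT`):

  `E(F₁(C^U_T) 1_{R_X}) · E(F₂(C^U_T) 1_{R_Y}) ≤ E((F₁F₂)(C^U_T) 1_{R_{X∩Y}}) · P(R_{X∪Y})`

(`bhk_multi_induced`; `bhk_multi` on the whole graph).  `T = {s}` is p1's `bhk_induced`, and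
`F_i = 1{A_i ⊆ ·}` is p1's `vdBK_multi`.  The proof is p1's exploration induction verbatim with
the seed set in place of the root: the case `X ∩ Y = ∅` is Harris' inequality; otherwise explore
the edges around `Z = X ∩ Y` (no source in `Z`, else the left side vanishes): on `R_{W ∪ Z}` the
union cluster in `G[U ∖ Z]` is the union cluster in `G[U]` (`clusterInT_sdiff_eq`), the tower
identity turns every term into a sum over the explored configuration, and the four functions
theorem on `Config E` closes the induction.  This is the lemma behind the three-root inequalities
NC13′ / NC12′ (`proofs/LEAD-PROOFSHAPES.md` §8.9 ADDENDUM 9 (3)).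
-/

namespace Summit.Ventures.PercRepro2

/-! ## Union-cluster functionals -/

section ClusterObsT

variable {V : Type*} {E : Type*} {R : Type*} {ends : E → Sym2 V} {U T : Finset V}

/-- The union cluster of the seed set `T` in `G[U]`: `C^U_T = ⋃_{s ∈ T} C^U_s`. -/
def clusterInT (ends : E → Sym2 V) (U T : Finset V) (ω : Config E) : Set V :=
  clusterSet ends (induced ends (↑U) ω) T

/-- Membership in `C^U_T`. -/
@[simp] lemma mem_clusterInT {ω : Config E} {x : V} :
    x ∈ clusterInT ends U T ω ↔ ∃ s ∈ T, Conn ends (induced ends (↑U) ω) s x := Iff.rfl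

/-- A functional of the union cluster of `T` in `G[U]`. -/
def clusterObsT (ends : E → Sym2 V) (U T : Finset V) (F : Set V → R) : Config E → R :=
  fun ω => F (clusterInT ends U T ω)

/-- Unfolding `clusterObsT`. -/
@[simp] lemma clusterObsT_apply (F : Set V → R) (ω : Config E) :
    clusterObsT ends U T F ω = F (clusterInT ends U T ω) := rfl

/-- The union cluster is monotone in the configuration. -/
lemma clusterInT_mono {ω ω' : Config E} (h : ω ≤ ω') :
    clusterInT ends U T ω ⊆ clusterInT ends U T ω' :=
  clusterSet_mono (induced_mono h) T

/-- A monotone functional gives a monotone observable. -/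
lemma monotone_clusterObsT [Preorder R] {F : Set V → R} (hF : Monotone F) :
    Monotone (clusterObsT ends U T F) :=
  fun _ _ h => hF (clusterInT_mono h)

/-- `clusterObsT` is determined by the edges inside `U`. -/
lemma dependsOn_clusterObsT (F : Set V → R) :
    DependsOn (clusterObsT ends U T F) (within ends (↑U)) := by
  intro ω ω' h
  simp only [clusterObsT_apply, clusterInT, induced_congr h]

/-- `clusterObsT` of a product is the product. -/
lemma clusterObsT_mul [Mul R] (F₁ F₂ : Set V → R) :
    clusterObsT ends U T (F₁ * F₂) = clusterObsT ends U T F₁ * clusterObsT ends U T F₂ := rfl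

/-- `clusterObsT` of the constant `1` is `1`. -/
lemma clusterObsT_one [One R] : clusterObsT ends U T (fun _ => (1 : R)) = 1 := rfl

/-- On `{T ↮ Z in G[U]}` the union cluster of `T` in `G[U ∖ Z]` is its union cluster in `G[U]`. -/
lemma clusterInT_sdiff_eq [DecidableEq V] {Z : Finset V} {ω : Config E}
    (hR : ∀ s ∈ T, ∀ z ∈ Z, ¬ Conn ends (induced ends (↑U) ω) s z) :
    clusterInT ends (U \ Z) T ω = clusterInT ends U T ω := by
  ext x
  simp only [mem_clusterInT]
  constructor
  · rintro ⟨s, hs, h⟩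
    exact ⟨s, hs, (mem_clusterIn (ends := ends) (U := U) (s := s)).1
      ((clusterIn_sdiff_eq (hR s hs)) ▸ (mem_clusterIn (U := U \ Z)).2 h)⟩
  · rintro ⟨s, hs, h⟩
    exact ⟨s, hs, (mem_clusterIn (ends := ends) (U := U \ Z) (s := s)).1
      ((clusterIn_sdiff_eq (hR s hs)).symm ▸ (mem_clusterIn (U := U)).2 h)⟩

end ClusterObsT

/-! ## The inequality on induced subgraphs -/

section MultiFunMain

variable {V : Type*} {E : Type*} [Fintype E] [DecidableEq E] [Fintype V] [DecidableEq V]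
  {R : Type*} [CommRing R] [LinearOrder R] [IsStrictOrderedRing R]

omit [Fintype E] [DecidableEq E] [Fintype V] [DecidableEq V] in
/-- Nonnegativity of `F(C_T) · 1_A` for a nonnegative functional. -/
lemma clusterObsT_mul_indicator_nonneg (ends : E → Sym2 V) (U T : Finset V) {F : Set V → R}
    (hF : ∀ S, 0 ≤ F S) (A : Set (Config E)) (ω : Config E) :
    0 ≤ (clusterObsT ends U T F * A.indicator (1 : Config E → R)) ω :=
  mul_nonneg (hF _) (Set.indicator_apply_nonneg fun _ => zero_le_one)

omit [Fintype V] [DecidableEq V] in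
/-- Monotonicity in the event: `E(F(C_T) 1_A) ≤ E(F(C_T) 1_B)` for `A ⊆ B` and `F ≥ 0`. -/
lemma expect_clusterObsT_mul_indicator_mono {p : E → R} (hp : IsProbVec p) (ends : E → Sym2 V)
    (U T : Finset V) {F : Set V → R} (hF : ∀ S, 0 ≤ F S) {A B : Set (Config E)} (hAB : A ⊆ B) :
    expect p (clusterObsT ends U T F * A.indicator 1) ≤
      expect p (clusterObsT ends U T F * B.indicator 1) := by
  refine expect_mono hp fun ω => ?_
  simp only [Pi.mul_apply]
  refine mul_le_mul_of_nonneg_left ?_ (hF _)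
  by_cases h : ω ∈ A
  · rw [Set.indicator_of_mem h, Set.indicator_of_mem (hAB h)]
  · rw [Set.indicator_of_notMem h]
    exact Set.indicator_apply_nonneg fun _ => zero_le_one

omit [Fintype V] in
/-- The case `X ∩ Y = ∅`: Harris' inequality three times. -/
lemma bhk_multi_induced_of_inter_eq_empty (p : E → R) (hp : IsProbVec p) (ends : E → Sym2 V)
    (U T : Finset V) {F₁ F₂ : Set V → R} (hF₁ : Monotone F₁) (hF₂ : Monotone F₂)
    (hF₁0 : ∀ S, 0 ≤ F₁ S) (hF₂0 : ∀ S, 0 ≤ F₂ S) (X Y : Finset V) (hZ : X ∩ Y = ∅) :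
    expect p (clusterObsT ends U T F₁ * (REventT ends U T X).indicator 1) *
        expect p (clusterObsT ends U T F₂ * (REventT ends U T Y).indicator 1) ≤
      expect p (clusterObsT ends U T (F₁ * F₂) * (REventT ends U T (X ∩ Y)).indicator 1) *
        prob p (REventT ends U T (X ∪ Y)) := by
  rw [hZ, REventT_empty, Set.indicator_univ, mul_one, REventT_union, clusterObsT_mul]
  have hRX := isLowerSet_REventT ends U T X
  have hRY := isLowerSet_REventT ends U T Y
  have h1 := expect_mul_indicator_le_of_isLowerSet hp
    (monotone_clusterObsT (ends := ends) (U := U) (T := T) hF₁) hRX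
  have h2 := expect_mul_indicator_le_of_isLowerSet hp
    (monotone_clusterObsT (ends := ends) (U := U) (T := T) hF₂) hRY
  have h3 := expect_mul_expect_le_expect_mul hp
    (monotone_clusterObsT (ends := ends) (U := U) (T := T) hF₁)
    (monotone_clusterObsT (ends := ends) (U := U) (T := T) hF₂)
  have h4 := prob_mul_prob_le_prob_inter_of_isLowerSet hp hRX hRY
  have n1 : 0 ≤ expect p (clusterObsT ends U T F₂ * (REventT ends U T Y).indicator 1) :=
    expect_nonneg hp (clusterObsT_mul_indicator_nonneg ends U T hF₂0 _)
  have n2 : 0 ≤ expect p (clusterObsT ends U T F₁) := expect_nonneg hp fun ω => hF₁0 _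
  have n3 : 0 ≤ expect p (clusterObsT ends U T F₁ * clusterObsT ends U T F₂) :=
    expect_nonneg hp fun ω => mul_nonneg (hF₁0 _) (hF₂0 _)
  calc expect p (clusterObsT ends U T F₁ * (REventT ends U T X).indicator 1) *
        expect p (clusterObsT ends U T F₂ * (REventT ends U T Y).indicator 1)
      ≤ (expect p (clusterObsT ends U T F₁) * prob p (REventT ends U T X)) *
          (expect p (clusterObsT ends U T F₂) * prob p (REventT ends U T Y)) :=
        mul_le_mul h1 h2 n1 (mul_nonneg n2 (prob_nonneg hp _))
    _ = (expect p (clusterObsT ends U T F₁) * expect p (clusterObsT ends U T F₂)) *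
          (prob p (REventT ends U T X) * prob p (REventT ends U T Y)) := by ring
    _ ≤ expect p (clusterObsT ends U T F₁ * clusterObsT ends U T F₂) *
          prob p (REventT ends U T X ∩ REventT ends U T Y) :=
        mul_le_mul h3 h4 (mul_nonneg (prob_nonneg hp _) (prob_nonneg hp _)) n3

omit [DecidableEq E] [Fintype V] [LinearOrder R] [IsStrictOrderedRing R] in
/-- **Pointwise transfer to `G[U ∖ Z]`**: if no source lies in `Z ⊆ U`,
`F(C^U_T) · 1_{R^U_{T,W ∪ Z}} = F(C^{U∖Z}_T) · 1_{R^{U∖Z}_{T,W ∪ frontier}}` configuration by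
configuration. -/
lemma clusterObsT_mul_indicator_eq (ends : E → Sym2 V) {U Z : Finset V} (hZU : Z ⊆ U)
    {T : Finset V} (hTZ : ∀ s ∈ T, s ∉ Z) (F : Set V → R) (W : Finset V) (ω : Config E) :
    (clusterObsT ends U T F * (REventT ends U T (W ∪ Z)).indicator (1 : Config E → R)) ω =
      (clusterObsT ends (U \ Z) T F *
        (REventT ends (U \ Z) T (W ∪ frontier ends U Z ω)).indicator (1 : Config E → R)) ω := by
  have key := Set.ext_iff.1
    (QEventT_inter_REventT_union_eq (ends := ends) hZU hTZ (fun _ => ∅) W) ω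
  simp only [QEventT_empty, Set.univ_inter, Set.mem_setOf_eq] at key
  simp only [Pi.mul_apply]
  by_cases h : ω ∈ REventT ends U T (W ∪ Z)
  · have hR : ∀ s ∈ T, ∀ z ∈ Z, ¬ Conn ends (induced ends (↑U) ω) s z :=
      fun s hs z hz => h s hs z (Finset.mem_union_right W hz)
    rw [Set.indicator_of_mem h, Set.indicator_of_mem (key.1 h), clusterObsT_apply,
      clusterObsT_apply, clusterInT_sdiff_eq hR]
  · rw [Set.indicator_of_notMem h, Set.indicator_of_notMem fun h' => h (key.2 h'), mul_zero,
      mul_zero]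

omit [LinearOrder R] [IsStrictOrderedRing R] in
/-- **Domain Markov identity for union-cluster functionals**: if no source lies in `Z ⊆ U`,
`E(F(C^U_T) 1_{R_{W∪Z}}) = ∑_ω weight p ω · E(F(C^{U∖Z}_T) 1_{R_{W ∪ frontier ω}})`. -/
theorem expect_clusterObsT_mul_indicator_eq_sum (p : E → R) (ends : E → Sym2 V)
    {U Z : Finset V} (hZU : Z ⊆ U) {T : Finset V} (hTZ : ∀ s ∈ T, s ∉ Z) (F : Set V → R)
    (W : Finset V) :
    expect p (clusterObsT ends U T F * (REventT ends U T (W ∪ Z)).indicator 1) =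
      ∑ ω, weight p ω * expect p (clusterObsT ends (U \ Z) T F *
        (REventT ends (U \ Z) T (W ∪ frontier ends U Z ω)).indicator 1) := by
  have e : (clusterObsT ends U T F * (REventT ends U T (W ∪ Z)).indicator (1 : Config E → R)) =
      fun ω => (clusterObsT ends (U \ Z) T F *
        (REventT ends (U \ Z) T (W ∪ frontier ends U Z ω)).indicator (1 : Config E → R)) ω :=
    funext fun ω => clusterObsT_mul_indicator_eq ends hZU hTZ F W ω
  rw [e]
  exact expect_tower p (F₁ := fun _ => touches ends (↑Z)) (F₂ := fun _ => within ends (↑(U \ Z)))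
    (S := frontier ends U Z)
    (Φ := fun S => clusterObsT ends (U \ Z) T F * (REventT ends (U \ Z) T (W ∪ S)).indicator 1)
    (fun _ => disjoint_touches_within_sdiff ends U Z)
    (fun S ω ω' h => by
      show (frontier ends U Z ω = S) = (frontier ends U Z ω' = S)
      rw [dependsOn_frontier ends U Z h])
    fun S => dependsOn_mul (dependsOn_clusterObsT F)
      (dependsOn_indicator (dependsOn_REventT ends (U \ Z) T (W ∪ S)))

/-- **Functional multi-source van den Berg–Häggström–Kahn on induced subgraphs**: for a seed set
`T`, nonnegative monotone functionals `F₁, F₂` of the union cluster, every vertex set `U` and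
`X, Y ⊆ U`,
`E(F₁(C^U_T) 1_{R_X}) · E(F₂(C^U_T) 1_{R_Y}) ≤ E((F₁F₂)(C^U_T) 1_{R_{X∩Y}}) · P(R_{X∪Y})`. -/
theorem bhk_multi_induced (p : E → R) (hp : IsProbVec p) (ends : E → Sym2 V) (T : Finset V)
    {F₁ F₂ : Set V → R} (hF₁ : Monotone F₁) (hF₂ : Monotone F₂) (hF₁0 : ∀ S, 0 ≤ F₁ S)
    (hF₂0 : ∀ S, 0 ≤ F₂ S) (U : Finset V) :
    ∀ X Y : Finset V, X ⊆ U → Y ⊆ U →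
      expect p (clusterObsT ends U T F₁ * (REventT ends U T X).indicator 1) *
          expect p (clusterObsT ends U T F₂ * (REventT ends U T Y).indicator 1) ≤
        expect p (clusterObsT ends U T (F₁ * F₂) * (REventT ends U T (X ∩ Y)).indicator 1) *
          prob p (REventT ends U T (X ∪ Y)) := by
  have hF0 : ∀ S, 0 ≤ (F₁ * F₂) S := fun S => mul_nonneg (hF₁0 S) (hF₂0 S)
  induction U using Finset.strongInduction with
  | H U ih =>
  intro X Y hX hY
  by_cases hZ : X ∩ Y = ∅
  · exact bhk_multi_induced_of_inter_eq_empty p hp ends U T hF₁ hF₂ hF₁0 hF₂0 X Y hZ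
  -- the exploration step: `Z = X ∩ Y ≠ ∅`
  set Z := X ∩ Y with hZdef
  have hZX : Z ⊆ X := Finset.inter_subset_left
  have hZY : Z ⊆ Y := Finset.inter_subset_right
  have hZU : Z ⊆ U := hZX.trans hX
  by_cases hTZ : ∃ s ∈ T, s ∈ Z
  · -- a source lies in `X`: the left side vanishes
    obtain ⟨s, hs, hsZ⟩ := hTZ
    have h0 : expect p (clusterObsT ends U T F₁ * (REventT ends U T X).indicator 1) = 0 := by
      rw [REventT_eq_empty_of_mem ends U hs (hZX hsZ)]
      simp [expect]
    rw [h0, zero_mul]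
    exact mul_nonneg (expect_nonneg hp (clusterObsT_mul_indicator_nonneg ends U T hF0 _))
      (prob_nonneg hp _)
  have hTZ' : ∀ s ∈ T, s ∉ Z := fun s hs hsZ => hTZ ⟨s, hs, hsZ⟩
  have hU' : U \ Z ⊂ U := Finset.sdiff_ssubset hZU (Finset.nonempty_iff_ne_empty.2 hZ)
  -- the four terms as sums over configurations (domain Markov identity)
  have e1 : expect p (clusterObsT ends U T F₁ * (REventT ends U T X).indicator 1) =
      ∑ ω, weight p ω * expect p (clusterObsT ends (U \ Z) T F₁ *
        (REventT ends (U \ Z) T ((X \ Z) ∪ frontier ends U Z ω)).indicator 1) := by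
    rw [← expect_clusterObsT_mul_indicator_eq_sum p ends hZU hTZ' F₁ (X \ Z),
      Finset.sdiff_union_of_subset hZX]
  have e2 : expect p (clusterObsT ends U T F₂ * (REventT ends U T Y).indicator 1) =
      ∑ ω, weight p ω * expect p (clusterObsT ends (U \ Z) T F₂ *
        (REventT ends (U \ Z) T ((Y \ Z) ∪ frontier ends U Z ω)).indicator 1) := by
    rw [← expect_clusterObsT_mul_indicator_eq_sum p ends hZU hTZ' F₂ (Y \ Z),
      Finset.sdiff_union_of_subset hZY]
  have e3 : expect p (clusterObsT ends U T (F₁ * F₂) * (REventT ends U T Z).indicator 1) =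
      ∑ ω, weight p ω * expect p (clusterObsT ends (U \ Z) T (F₁ * F₂) *
        (REventT ends (U \ Z) T (∅ ∪ frontier ends U Z ω)).indicator 1) := by
    rw [← expect_clusterObsT_mul_indicator_eq_sum p ends hZU hTZ' (F₁ * F₂) ∅,
      Finset.empty_union]
  have e4 : prob p (REventT ends U T (X ∪ Y)) =
      ∑ ω, weight p ω * expect p (clusterObsT ends (U \ Z) T (fun _ => 1) *
        (REventT ends (U \ Z) T (((X \ Z) ∪ (Y \ Z)) ∪ frontier ends U Z ω)).indicator 1) := by
    rw [← expect_clusterObsT_mul_indicator_eq_sum p ends hZU hTZ' (fun _ => 1)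
      ((X \ Z) ∪ (Y \ Z)), clusterObsT_one, one_mul, ← prob_eq_expect_indicator,
      ← Finset.union_sdiff_distrib,
      Finset.sdiff_union_of_subset (hZX.trans Finset.subset_union_left)]
  rw [e1, e2, e3, e4]
  -- the four functions theorem on the lattice `Config E`
  refine four_functions_theorem_univ
    (fun ω => weight p ω * expect p (clusterObsT ends (U \ Z) T F₁ *
      (REventT ends (U \ Z) T ((X \ Z) ∪ frontier ends U Z ω)).indicator 1))
    (fun ω => weight p ω * expect p (clusterObsT ends (U \ Z) T F₂ *
      (REventT ends (U \ Z) T ((Y \ Z) ∪ frontier ends U Z ω)).indicator 1))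
    (fun ω => weight p ω * expect p (clusterObsT ends (U \ Z) T (F₁ * F₂) *
      (REventT ends (U \ Z) T (∅ ∪ frontier ends U Z ω)).indicator 1))
    (fun ω => weight p ω * expect p (clusterObsT ends (U \ Z) T (fun _ => 1) *
      (REventT ends (U \ Z) T (((X \ Z) ∪ (Y \ Z)) ∪ frontier ends U Z ω)).indicator 1))
    (fun ω => mul_nonneg (weight_nonneg hp ω)
      (expect_nonneg hp (clusterObsT_mul_indicator_nonneg ends _ T hF₁0 _)))
    (fun ω => mul_nonneg (weight_nonneg hp ω)
      (expect_nonneg hp (clusterObsT_mul_indicator_nonneg ends _ T hF₂0 _)))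
    (fun ω => mul_nonneg (weight_nonneg hp ω)
      (expect_nonneg hp (clusterObsT_mul_indicator_nonneg ends _ T hF0 _)))
    (fun ω => mul_nonneg (weight_nonneg hp ω)
      (expect_nonneg hp (clusterObsT_mul_indicator_nonneg ends _ T (fun _ => zero_le_one) _))) ?_
  intro ω ω'
  -- induction hypothesis on `U ∖ Z` with the frontiers added to the avoided sets
  have hX'' : (X \ Z) ∪ frontier ends U Z ω ⊆ U \ Z :=
    Finset.union_subset (Finset.sdiff_subset_sdiff hX (le_refl Z)) (frontier_subset ω)
  have hY'' : (Y \ Z) ∪ frontier ends U Z ω' ⊆ U \ Z :=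
    Finset.union_subset (Finset.sdiff_subset_sdiff hY (le_refl Z)) (frontier_subset ω')
  have hIH := ih (U \ Z) hU' ((X \ Z) ∪ frontier ends U Z ω) ((Y \ Z) ∪ frontier ends U Z ω')
    hX'' hY''
  -- `S(ω ⊓ ω') ⊆ S(ω) ∩ S(ω') ⊆ X'' ∩ Y''`
  have h3 : expect p (clusterObsT ends (U \ Z) T (F₁ * F₂) * (REventT ends (U \ Z) T
      (((X \ Z) ∪ frontier ends U Z ω) ∩ ((Y \ Z) ∪ frontier ends U Z ω'))).indicator 1) ≤
      expect p (clusterObsT ends (U \ Z) T (F₁ * F₂) *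
        (REventT ends (U \ Z) T (∅ ∪ frontier ends U Z (ω ⊓ ω'))).indicator 1) := by
    refine expect_clusterObsT_mul_indicator_mono hp ends _ T hF0 (REventT_anti _ _ _ ?_)
    rw [Finset.empty_union]
    exact (frontier_inf_subset ω ω').trans
      (Finset.inter_subset_inter Finset.subset_union_right Finset.subset_union_right)
  -- `X'' ∪ Y'' = (X' ∪ Y') ∪ S(ω ⊔ ω')`
  have h4 : prob p (REventT ends (U \ Z) T
      (((X \ Z) ∪ frontier ends U Z ω) ∪ ((Y \ Z) ∪ frontier ends U Z ω'))) =
      expect p (clusterObsT ends (U \ Z) T (fun _ => 1) *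
        (REventT ends (U \ Z) T (((X \ Z) ∪ (Y \ Z)) ∪
          frontier ends U Z (ω ⊔ ω'))).indicator 1) := by
    rw [clusterObsT_one, one_mul, ← prob_eq_expect_indicator, frontier_sup]
    congr 2
    ext x
    simp only [Finset.mem_union]
    tauto
  have n3 : 0 ≤ expect p (clusterObsT ends (U \ Z) T (F₁ * F₂) *
      (REventT ends (U \ Z) T (∅ ∪ frontier ends U Z (ω ⊓ ω'))).indicator 1) :=
    expect_nonneg hp (clusterObsT_mul_indicator_nonneg ends _ T hF0 _)
  have n4 : 0 ≤ prob p (REventT ends (U \ Z) T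
      (((X \ Z) ∪ frontier ends U Z ω) ∪ ((Y \ Z) ∪ frontier ends U Z ω'))) := prob_nonneg hp _
  calc weight p ω * expect p (clusterObsT ends (U \ Z) T F₁ *
          (REventT ends (U \ Z) T ((X \ Z) ∪ frontier ends U Z ω)).indicator 1) *
        (weight p ω' * expect p (clusterObsT ends (U \ Z) T F₂ *
          (REventT ends (U \ Z) T ((Y \ Z) ∪ frontier ends U Z ω')).indicator 1))
      = (weight p ω * weight p ω') *
          (expect p (clusterObsT ends (U \ Z) T F₁ *
            (REventT ends (U \ Z) T ((X \ Z) ∪ frontier ends U Z ω)).indicator 1) *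
          expect p (clusterObsT ends (U \ Z) T F₂ *
            (REventT ends (U \ Z) T ((Y \ Z) ∪ frontier ends U Z ω')).indicator 1)) := by ring
    _ ≤ (weight p ω * weight p ω') *
          (expect p (clusterObsT ends (U \ Z) T (F₁ * F₂) *
            (REventT ends (U \ Z) T (∅ ∪ frontier ends U Z (ω ⊓ ω'))).indicator 1) *
          expect p (clusterObsT ends (U \ Z) T (fun _ => 1) *
            (REventT ends (U \ Z) T (((X \ Z) ∪ (Y \ Z)) ∪
              frontier ends U Z (ω ⊔ ω'))).indicator 1)) :=
        mul_le_mul_of_nonneg_left (hIH.trans (mul_le_mul h3 (le_of_eq h4) n4 n3))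
          (mul_nonneg (weight_nonneg hp ω) (weight_nonneg hp ω'))
    _ = weight p (ω ⊓ ω') * expect p (clusterObsT ends (U \ Z) T (F₁ * F₂) *
          (REventT ends (U \ Z) T (∅ ∪ frontier ends U Z (ω ⊓ ω'))).indicator 1) *
        (weight p (ω ⊔ ω') * expect p (clusterObsT ends (U \ Z) T (fun _ => 1) *
          (REventT ends (U \ Z) T (((X \ Z) ∪ (Y \ Z)) ∪
            frontier ends U Z (ω ⊔ ω'))).indicator 1)) := by
        rw [← weight_inf_mul_weight_sup p ω ω']
        ring

end MultiFunMain

/-! ## The whole graph -/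

section Whole

variable {V : Type*} {E : Type*} [Fintype E] [DecidableEq E] [Fintype V] [DecidableEq V]
  {R : Type*} [CommRing R] [LinearOrder R] [IsStrictOrderedRing R]

omit [Fintype E] [DecidableEq E] [DecidableEq V] in
/-- The union cluster in `G[V]` is the union cluster of the whole graph. -/
lemma clusterInT_univ (ends : E → Sym2 V) (T : Finset V) (ω : Config E) :
    clusterInT ends Finset.univ T ω = clusterSet ends ω T := by
  simp only [clusterInT, Finset.coe_univ, induced_univ]

omit [Fintype E] [DecidableEq E] [DecidableEq V] in
/-- `R^V_{T,X}` is the avoidance event of the whole graph. -/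
lemma REventT_univ' (ends : E → Sym2 V) (T X : Finset V) :
    REventT ends Finset.univ T X = avoidAllT ends T X := REventT_univ ends T X

/-- **Functional multi-source van den Berg–Häggström–Kahn** on the whole graph: for a seed set
`T`, nonnegative monotone functionals `F₁, F₂` of the union cluster `C(T)` and vertex sets
`X, Y`, with `R_X = {s ↮ x ∀ s ∈ T, x ∈ X}`,
`E(F₁(C(T)) 1_{R_X}) · E(F₂(C(T)) 1_{R_Y}) ≤ E((F₁F₂)(C(T)) 1_{R_{X∩Y}}) · P(R_{X∪Y})`. -/
theorem bhk_multi (p : E → R) (hp : IsProbVec p) (ends : E → Sym2 V) (T : Finset V)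
    {F₁ F₂ : Set V → R} (hF₁ : Monotone F₁) (hF₂ : Monotone F₂) (hF₁0 : ∀ S, 0 ≤ F₁ S)
    (hF₂0 : ∀ S, 0 ≤ F₂ S) (X Y : Finset V) :
    expect p (fun ω => F₁ (clusterSet ends ω T) * (avoidAllT ends T X).indicator 1 ω) *
        expect p (fun ω => F₂ (clusterSet ends ω T) * (avoidAllT ends T Y).indicator 1 ω) ≤
      expect p (fun ω => (F₁ * F₂) (clusterSet ends ω T) *
          (avoidAllT ends T (X ∩ Y)).indicator 1 ω) *
        prob p (avoidAllT ends T (X ∪ Y)) := by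
  have h := bhk_multi_induced p hp ends T hF₁ hF₂ hF₁0 hF₂0 Finset.univ X Y
    (Finset.subset_univ X) (Finset.subset_univ Y)
  simp only [REventT_univ'] at h
  have e : ∀ (F : Set V → R) (A : Set (Config E)),
      (clusterObsT ends Finset.univ T F * A.indicator (1 : Config E → R)) =
        fun ω => F (clusterSet ends ω T) * A.indicator 1 ω := by
    intro F A
    funext ω
    simp only [Pi.mul_apply, clusterObsT_apply, clusterInT_univ]
  simpa only [e] using h

end Whole

end Summit.Ventures.PercRepro2
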